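import Summits.KontsevichZagierPeriods.KontsevichZagierPeriods.Theorems.HyperbolicBlochOffTetraSectorKernelStubRayChain
import Summits.KontsevichZagierPeriods.KontsevichZagierPeriods.Theorems.HyperbolicBlochOffTetraSectorKernelStubConjCarriers
import Summits.KontsevichZagierPeriods.KontsevichZagierPeriods.Theorems.HyperbolicBlochOffTetraSectorKernelStubKthRootsExist
import Summits.KontsevichZagierPeriods.KontsevichZagierPeriods.Theorems.HyperbolicBlochOffTetraSectorKernelStubRootsPartialFractions
import Summits.KontsevichZagierPeriods.KontsevichZagierPeriods.Theorems.HyperbolicBlochOffTetraSectorKernelStubBandPartialFractions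
import Summits.KontsevichZagierPeriods.KontsevichZagierPeriods.Theorems.HyperbolicBlochOffTetraSectorKernelStubBandPowerSubst
import Summits.KontsevichZagierPeriods.KontsevichZagierPeriods.Theorems.HyperbolicBlochOffTetraSectorKernelStubBandLogPower
import Summits.KontsevichZagierPeriods.KontsevichZagierPeriods.Theorems.HyperbolicBlochOffTetraSectorKernelStubArcDistribution
import Summits.KontsevichZagierPeriods.KontsevichZagierPeriods.Theorems.HyperbolicBlochOffTetraSectorKernelStubLogSheetPower
import Summits.KontsevichZagierPeriods.KontsevichZagierPeriods.Theorems.HyperbolicBlochOffTetraSectorKernelStubLogBandsExist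
import Summits.KontsevichZagierPeriods.KontsevichZagierPeriods.Theorems.HyperbolicBlochOffTetraSectorKernelStubRayCarriersExist
import Literature.NumberTheory.Transcendental.KZProductIdeal
import Literature.NumberTheory.Transcendental.KZPeriodsProofs
import Literature.NumberTheory.Transcendental.KZVolumeConjectureProofs

/-!
# `OffTetraSectorKernel` (stmt-KontsevichZagierPeriods-10557), line `odd-hyperbolic-ladder` v11: the distribution relations

**The distribution relations of the Bloch–Wigner oracle are Kontsevich–Zagier moves** (`stub_distribution`, the lead
stub of skeleton v11). For every admissible tetrahedral family `ρ` (representations `[T(z), t⁻³]` of the ideal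
tetrahedra `T(∞,0,1,z)`, `z ∈ ℚ̄ ∩ ℍ⁺`), every `k ≥ 1` and every algebraic `z ∈ ℍ⁺`:
`[ρ z] − k · Σⱼ εⱼ [ρ uⱼ] ∈ KZ.relations`, where `wⱼ` runs over the `k`-th roots of `z`, `uⱼ = wⱼ`, `εⱼ = 1` if
`Im wⱼ > 0` and `uⱼ = w̄ⱼ`, `εⱼ = −1` if `Im wⱼ < 0` — the KZ-shadow of `D(z) = k Σ_{w^k = z} D(w)`, i.e. of the
divisibility of the Bloch group of `ℚ̄` (Dupont–Sah), obtained here by ELEMENTARY moves on Zagier's ray integral: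
`[ρ z] ≡ [Band₁(z)] − [C(z)]·[Λ±(|z|)]` (`stub_rayChain`: Milnor bridge, `u = v²`, the two-sheeted splitting), the band
distribution `[Band₁(z)] ≡ k Σⱼ [Band₁(wⱼ)]` (power substitution `s = t^k`, partial fractions over the roots, the
unfolded product rule `log t^{-k} = k log t^{-1}`), the arc distribution `[C(z)] ≡ Σⱼ [C(wⱼ)]`, `log |z| = k log |wⱼ|`
on the signed log sheet, the product ideal of the formal period ring, and conjugation for the roots below the axis.
Corollaries for the standard family `KZ.idealTetrahedronRep` (`distribution_idealTetrahedronRep`) and, by soundness alone,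
the distribution relations of the VALUES `vol T(z)` / `D(z) = KZ.rayDilog` (`idealTetrahedronVolume_distribution`,
`rayDilog_distribution`).

References: D. Zagier, *The dilogarithm function* (2007), Ch. I §2 (the distribution relations); J. L. Dupont,
C.-H. Sah, *Scissors congruences II* (1982), §5; M. Kontsevich, D. Zagier, *Periods* (2001), §1.2.
-/

noncomputable section

open Set MeasureTheory
open Literature.NumberTheory.Transcendental

namespace Summit.KontsevichZagierPeriods.HyperbolicBloch.OffTetraSectorKernel

/-- The modulus of a complex number algebraic over `ℚ` is a real algebraic number (`|z|² = (Re z)² + (Im z)²`).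
[folklore] -/
theorem distribution_isAlgebraic_norm {z : ℂ} (hz : IsAlgebraic ℚ z) : IsAlgebraic ℚ ‖z‖ := by
  obtain ⟨hre, him⟩ := isAlgebraic_re_im hz
  have h2 : IsAlgebraic ℚ (‖z‖ ^ 2) := by
    rw [Complex.sq_norm, Complex.normSq_apply]
    exact (hre.mul hre).add (him.mul him)
  exact IsAlgebraic.of_pow two_pos h2

/-- The log band `Band₁(a, b) = [{0 < s < 1, 1 ≤ u ≤ 1/s}, g(s)/u]` exists as an integral representation
(`stub_logBandsExist` at `k = 1`). [cite: KontsevichZagier2001, §1.1] -/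
theorem distribution_band_exists (a b : ℝ) (ha : IsAlgebraic ℚ a) (hb : IsAlgebraic ℚ b) :
    ∃ B : KZ.IntegralRep 2, B.domain = {w | (0 < w 0 ∧ w 0 < 1) ∧ 1 ≤ w 1 ∧ w 1 ≤ 1 / w 0} ∧
      B.integrand = fun w => b / ((1 - w 0 * a) ^ 2 + (w 0 * b) ^ 2) / w 1 := by
  obtain ⟨B, hBd, hBi⟩ := stub_logBandsExist.1 1 le_rfl a b ha hb
  refine ⟨B, ?_, hBi⟩
  rw [hBd]
  simp only [pow_one]

/-- An equality of integrands gives agreement on any set. [folklore] -/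
theorem distribution_eqOn_of_eq {n : ℕ} {f g : (Fin n → ℝ) → ℝ} (h : f = g) (s : Set (Fin n → ℝ)) :
    EqOn f g s := fun x _ => by rw [h]

/-- **The distribution relations of the Bloch–Wigner oracle as Kontsevich–Zagier moves** (registered stub
`stub_distribution` of line `odd-hyperbolic-ladder`, skeleton v11): for every admissible tetrahedral family `ρ`, every
`k ≥ 1` and every algebraic `z ∈ ℍ⁺` there are `k` algebraic points `uⱼ ∈ ℍ⁺` and signs `εⱼ ∈ {±1}` with
`[ρ z] − k · Σⱼ εⱼ [ρ uⱼ] ∈ KZ.relations` (`uⱼ` the `k`-th roots of `z` reflected into `ℍ⁺`).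
[cite: Zagier2007Dilogarithm, Ch. I §2] -/
theorem stub_distribution :
    ∀ (T : ℂ → Set (Fin 3 → ℝ)), (∀ z, T z = {p | 0 < p 1 ∧ z.re * p 1 < z.im * p 0 ∧ z.im * (p 0 - 1) < (z.re - 1) * p 1 ∧ 0 < p 2 ∧ 0 < z.im * (p 0 ^ 2 + p 1 ^ 2 + p 2 ^ 2 - p 0) + (z.re - Complex.normSq z) * p 1}) →
    ∀ (ρ : ℂ → KZ.IntegralRep 3), (∀ z, IsAlgebraic ℚ z → 0 < z.im → (ρ z).domain = T z ∧
      Set.EqOn (ρ z).integrand (fun p => 1 / p 2 ^ 3) (T z)) →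
    ∀ (k : ℕ), 1 ≤ k → ∀ (z : ℂ), IsAlgebraic ℚ z → 0 < z.im →
      ∃ (u : Fin k → ℂ) (ε : Fin k → ℤ), (∀ j, IsAlgebraic ℚ (u j)) ∧ (∀ j, 0 < (u j).im) ∧
        KZ.of (ρ z) - k • ∑ j, ε j • KZ.of (ρ (u j)) ∈ KZ.relations := by
  intro T hT ρ hρ k hk z hz him
  classical
  have hk0 : k ≠ 0 := by omega
  -- admissibility of `ρ` in the form `stub_rayChain` wants
  have hρd : ∀ c : ℂ, IsAlgebraic ℚ c → 0 < c.im → (ρ c).domain = {p | 0 < p 1 ∧ c.re * p 1 < c.im * p 0 ∧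
      c.im * (p 0 - 1) < (c.re - 1) * p 1 ∧ 0 < p 2 ∧
      0 < c.im * (p 0 ^ 2 + p 1 ^ 2 + p 2 ^ 2 - p 0) + (c.re - Complex.normSq c) * p 1} :=
    fun c hc hci => ((hρ c hc hci).1.trans (hT c))
  have hρi : ∀ c : ℂ, IsAlgebraic ℚ c → 0 < c.im → EqOn (ρ c).integrand (fun p => 1 / p 2 ^ 3) (ρ c).domain :=
    fun c hc hci x hx => (hρ c hc hci).2 ((hρ c hc hci).1 ▸ hx)
  -- the `k`-th roots of `z` and the partial-fraction identity
  obtain ⟨w, hprod, hwalg, hwim, hwnorm⟩ := stub_kthRootsExist k hk z hz him.ne'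
  have hid := stub_rootsPartialFractions k hk z w hprod him.ne'
  obtain ⟨hre, himalg⟩ := isAlgebraic_re_im hz
  have hwre : ∀ j, IsAlgebraic ℚ (w j).re := fun j => (isAlgebraic_re_im (hwalg j)).1
  have hwimalg : ∀ j, IsAlgebraic ℚ (w j).im := fun j => (isAlgebraic_re_im (hwalg j)).2
  -- the radii `r = |z|` and `r₁ = |z|^{1/k} = |wⱼ|`
  have j₀ : Fin k := ⟨0, by omega⟩
  set r : ℝ := ‖z‖ with hr_def
  set r₁ : ℝ := ‖w j₀‖ with hr₁_def
  have hz0 : z ≠ 0 := fun h => by simp [h] at him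
  have hr0 : 0 < r := norm_pos_iff.mpr hz0
  have hw0 : ∀ j, w j ≠ 0 := fun j h => hwim j (by simp [h])
  have hr₁0 : 0 < r₁ := norm_pos_iff.mpr (hw0 j₀)
  have hr₁k : r₁ ^ k = r := hwnorm j₀
  have hnorm_eq : ∀ j, ‖w j‖ = r₁ := fun j =>
    (pow_left_inj₀ (norm_nonneg _) (norm_nonneg _) hk0).mp (by rw [hwnorm j, hr₁k])
  have hralg : IsAlgebraic ℚ r := distribution_isAlgebraic_norm hz
  have hr₁alg : IsAlgebraic ℚ r₁ := distribution_isAlgebraic_norm (hwalg j₀)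
  have hnsq : ∀ c : ℂ, ‖c‖ ^ 2 = c.re ^ 2 + c.im ^ 2 := fun c => by
    rw [Complex.sq_norm, Complex.normSq_apply]
    ring
  have hconj_alg : ∀ c : ℂ, IsAlgebraic ℚ c → IsAlgebraic ℚ (starRingEnd ℂ c) := fun c hc =>
    hc.algHom ((starRingEnd ℂ : ℂ →+* ℂ).toRatAlgHom)
  have hr2 : r ^ 2 = z.re ^ 2 + z.im ^ 2 := hnsq z
  have hr₁2 : ∀ j, r₁ ^ 2 = (w j).re ^ 2 + (w j).im ^ 2 := fun j => by
    rw [← hnorm_eq j]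
    exact hnsq (w j)
  -- carriers for `z`
  obtain ⟨B, hBd, hBi⟩ := distribution_band_exists z.re z.im hre himalg
  obtain ⟨C, hCd, hCi⟩ := stub_rayCarriersExist.1 z.re z.im hre himalg
  obtain ⟨L, hLd, hLi⟩ := stub_rayCarriersExist.2.1 r hralg hr0
  obtain ⟨L₁, hL₁d, hL₁i⟩ := stub_rayCarriersExist.2.1 r₁ hr₁alg hr₁0
  -- carriers for the roots
  choose Bw hBwd hBwi using fun j => distribution_band_exists (w j).re (w j).im (hwre j) (hwimalg j)
  choose Cw hCwd hCwi using fun j => stub_rayCarriersExist.1 (w j).re (w j).im (hwre j) (hwimalg j)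
  -- (A) the ray chain at `z`: `[ρ z] ≡ [B] − [C]·[L]`
  have hA : KZ.of (ρ z) - KZ.of B + KZ.of C * KZ.of L ∈ KZ.relations :=
    stub_rayChain z hz him r hralg hr0 hr2 (ρ z) B C L (hρd z hz him) (hρi z hz him) hBd
      (distribution_eqOn_of_eq hBi _) hCd (distribution_eqOn_of_eq hCi _) hLd (distribution_eqOn_of_eq hLi _)
  -- (B) the band distribution: `[B] ≡ k Σⱼ [Bwⱼ]`
  have hBand : KZ.of B - k • ∑ j, KZ.of (Bw j) ∈ KZ.relations := by
    obtain ⟨Bk, hBkd, hBki⟩ := stub_logBandsExist.2 k hk z.re z.im hre himalg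
    choose F hFd hFi using fun j => stub_logBandsExist.1 k hk (w j).re (w j).im (hwre j) (hwimalg j)
    have h1 : KZ.of Bk - KZ.of B ∈ KZ.relations :=
      stub_bandPowerSubst k hk z.re z.im hre himalg B Bk hBd (distribution_eqOn_of_eq hBi _) hBkd
        (distribution_eqOn_of_eq hBki _)
    have h2 : KZ.of Bk - ∑ j, KZ.of (F j) ∈ KZ.relations :=
      stub_bandPartialFractions k hk z w hz hwalg hid Bk F hBkd (distribution_eqOn_of_eq hBki _) hFd
        (fun j => distribution_eqOn_of_eq (hFi j) _)
    have h3 : ∀ j, KZ.of (F j) - k • KZ.of (Bw j) ∈ KZ.relations := fun j =>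
      stub_bandLogPower k hk (w j).re (w j).im (hwre j) (hwimalg j) (F j) (Bw j) (hFd j)
        (distribution_eqOn_of_eq (hFi j) _) (hBwd j) (distribution_eqOn_of_eq (hBwi j) _)
    have key : KZ.of B - k • ∑ j, KZ.of (Bw j) =
        -(KZ.of Bk - KZ.of B) + (KZ.of Bk - ∑ j, KZ.of (F j)) + ∑ j, (KZ.of (F j) - k • KZ.of (Bw j)) := by
      rw [Finset.sum_sub_distrib, Finset.smul_sum]
      abel
    rw [key]
    exact add_mem (add_mem (neg_mem h1) h2) (sum_mem fun j _ => h3 j)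
  -- (C) the arc distribution: `[C] ≡ Σⱼ [Cwⱼ]`
  have hArc : KZ.of C - ∑ j, KZ.of (Cw j) ∈ KZ.relations :=
    stub_arcDistribution k hk z w hz hwalg hid C Cw hCd (distribution_eqOn_of_eq hCi _) hCwd
      (fun j => distribution_eqOn_of_eq (hCwi j) _)
  -- (D) the log sheet: `[Λ(r)] ≡ k [Λ(r₁)]`
  have hSheet : KZ.of L - k • KZ.of L₁ ∈ KZ.relations := by
    refine stub_logSheetPower k hk r₁ hr₁alg hr₁0 L₁ L hL₁d (distribution_eqOn_of_eq hL₁i _) ?_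
      (distribution_eqOn_of_eq hLi _)
    rw [hr₁k]
    exact hLd
  -- (E) the product: `[C]·[L] ≡ k Σⱼ [Cwⱼ]·[Λ(r₁)]`
  have hProd : KZ.of C * KZ.of L - k • ∑ j, KZ.of (Cw j) * KZ.of L₁ ∈ KZ.relations := by
    have h := KZ.mul_sub_mul_mem_relations hArc hSheet
    have key : (∑ j, KZ.of (Cw j)) * (k • KZ.of L₁) = k • ∑ j, KZ.of (Cw j) * KZ.of L₁ := by
      rw [Finset.sum_mul, Finset.smul_sum]
      exact Finset.sum_congr rfl fun j _ => mul_smul_comm _ _ _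
    rwa [key] at h
  -- (F) the points `uⱼ` and signs `εⱼ`
  refine ⟨fun j => if 0 < (w j).im then w j else starRingEnd ℂ (w j),
    fun j => if 0 < (w j).im then 1 else -1, fun j => ?_, fun j => ?_, ?_⟩
  · by_cases hj : 0 < (w j).im
    · simp only [if_pos hj]
      exact hwalg j
    · simp only [if_neg hj]
      exact hconj_alg _ (hwalg j)
  · by_cases hj : 0 < (w j).im
    · simp only [if_pos hj]
      exact hj
    · simp only [if_neg hj, Complex.conj_im, Left.neg_pos_iff]
      exact lt_of_le_of_ne (not_lt.mp hj) (hwim j)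
  -- (G) per root: `[Bwⱼ] − [Cwⱼ]·[Λ(r₁)] ≡ εⱼ [ρ uⱼ]`
  have hRoot : ∀ j, KZ.of (Bw j) - KZ.of (Cw j) * KZ.of L₁ -
      (if 0 < (w j).im then (1 : ℤ) else -1) • KZ.of (ρ (if 0 < (w j).im then w j else starRingEnd ℂ (w j))) ∈
        KZ.relations := by
    intro j
    by_cases hj : 0 < (w j).im
    · simp only [if_pos hj, one_zsmul]
      have hch := stub_rayChain (w j) (hwalg j) hj r₁ hr₁alg hr₁0 (hr₁2 j) (ρ (w j)) (Bw j) (Cw j) L₁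
        (hρd (w j) (hwalg j) hj) (hρi (w j) (hwalg j) hj) (hBwd j) (distribution_eqOn_of_eq (hBwi j) _)
        (hCwd j) (distribution_eqOn_of_eq (hCwi j) _) hL₁d (distribution_eqOn_of_eq hL₁i _)
      have key : KZ.of (Bw j) - KZ.of (Cw j) * KZ.of L₁ - KZ.of (ρ (w j)) =
          -(KZ.of (ρ (w j)) - KZ.of (Bw j) + KZ.of (Cw j) * KZ.of L₁) := by abel
      rw [key]
      exact neg_mem hch
    · simp only [if_neg hj, neg_smul, one_zsmul, sub_neg_eq_add]
      have hlt : (w j).im < 0 := lt_of_le_of_ne (not_lt.mp hj) (hwim j)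
      set w' : ℂ := starRingEnd ℂ (w j) with hw'_def
      have hw're : w'.re = (w j).re := Complex.conj_re _
      have hw'im : w'.im = -(w j).im := Complex.conj_im _
      have hw'pos : 0 < w'.im := by
        rw [hw'im]
        linarith
      have hw'alg : IsAlgebraic ℚ w' := hconj_alg _ (hwalg j)
      have hw're_alg : IsAlgebraic ℚ w'.re := hw're ▸ hwre j
      have hw'im_alg : IsAlgebraic ℚ w'.im := hw'im ▸ (hwimalg j).neg
      obtain ⟨B', hB'd, hB'i⟩ := distribution_band_exists w'.re w'.im hw're_alg hw'im_alg
      obtain ⟨C', hC'd, hC'i⟩ := stub_rayCarriersExist.1 w'.re w'.im hw're_alg hw'im_alg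
      have hconj := stub_conjCarriers (w j) w' hw're hw'im (Bw j) B' (Cw j) C' (hBwd j)
        (distribution_eqOn_of_eq (hBwi j) _) hB'd (distribution_eqOn_of_eq hB'i _) (hCwd j)
        (distribution_eqOn_of_eq (hCwi j) _) hC'd (distribution_eqOn_of_eq hC'i _)
      have hr₁2' : r₁ ^ 2 = w'.re ^ 2 + w'.im ^ 2 := by
        rw [hw're, hw'im, neg_sq]
        exact hr₁2 j
      have hch := stub_rayChain w' hw'alg hw'pos r₁ hr₁alg hr₁0 hr₁2' (ρ w') B' C' L₁
        (hρd w' hw'alg hw'pos) (hρi w' hw'alg hw'pos) hB'd (distribution_eqOn_of_eq hB'i _)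
        hC'd (distribution_eqOn_of_eq hC'i _) hL₁d (distribution_eqOn_of_eq hL₁i _)
      -- `[Cwⱼ]·[L₁] + [C']·[L₁] ∈ relations` (the product ideal)
      have hCL : KZ.of (Cw j) * KZ.of L₁ + KZ.of C' * KZ.of L₁ ∈ KZ.relations := by
        have h1 : KZ.of (Cw j) - (-KZ.of C') ∈ KZ.relations := by
          rw [sub_neg_eq_add]
          exact hconj.2
        have h2 : KZ.of L₁ - KZ.of L₁ ∈ KZ.relations := by
          rw [sub_self]
          exact zero_mem _
        have h := KZ.mul_sub_mul_mem_relations h1 h2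
        rwa [neg_mul, sub_neg_eq_add] at h
      have key : KZ.of (Bw j) - KZ.of (Cw j) * KZ.of L₁ + KZ.of (ρ w') =
          (KZ.of (Bw j) + KZ.of B') - (KZ.of (Cw j) * KZ.of L₁ + KZ.of C' * KZ.of L₁) +
            (KZ.of (ρ w') - KZ.of B' + KZ.of C' * KZ.of L₁) := by abel
      rw [key]
      exact add_mem (sub_mem hconj.1 hCL) hch
  -- (H) summation
  have key : KZ.of (ρ z) - k • ∑ j, (if 0 < (w j).im then (1 : ℤ) else -1) •
      KZ.of (ρ (if 0 < (w j).im then w j else starRingEnd ℂ (w j))) =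
      (KZ.of (ρ z) - KZ.of B + KZ.of C * KZ.of L) + (KZ.of B - k • ∑ j, KZ.of (Bw j))
        - (KZ.of C * KZ.of L - k • ∑ j, KZ.of (Cw j) * KZ.of L₁)
        + k • ∑ j, (KZ.of (Bw j) - KZ.of (Cw j) * KZ.of L₁ - (if 0 < (w j).im then (1 : ℤ) else -1) •
            KZ.of (ρ (if 0 < (w j).im then w j else starRingEnd ℂ (w j)))) := by
    simp only [Finset.sum_sub_distrib, smul_sub]
    abel
  rw [key]
  exact add_mem (sub_mem (add_mem hA hBand) hProd) (AddSubgroup.nsmul_mem _ (sum_mem fun j _ => hRoot j) k)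

/-! ## Corollaries for the standard family `KZ.idealTetrahedronRep` and the values -/

/-- The standard representations `KZ.idealTetrahedronRep z` (`z ∈ ℚ̄ ∩ ℍ⁺`) extend to an admissible tetrahedral family
(the empty representation elsewhere). [cite: Milnor1982, Appendix, Lemma 2] -/
theorem distribution_exists_standardFamily :
    ∃ ρ : ℂ → KZ.IntegralRep 3, ∀ (z : ℂ) (hz : IsAlgebraic ℚ z) (him : 0 < z.im),
      ρ z = KZ.idealTetrahedronRep z hz him := by
  classical
  refine ⟨fun z => if h : IsAlgebraic ℚ z ∧ 0 < z.im then KZ.idealTetrahedronRep z h.1 h.2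
    else KZ.IntegralRep.empty 3, fun z hz him => ?_⟩
  have h : IsAlgebraic ℚ z ∧ 0 < z.im := ⟨hz, him⟩
  simp only [dif_pos h]

/-- **The distribution relations for the standard ideal tetrahedra, as Kontsevich–Zagier moves**: for `k ≥ 1` and
`z ∈ ℚ̄ ∩ ℍ⁺` there are algebraic `u₀, …, u_{k−1} ∈ ℍ⁺` (the `k`-th roots of `z` reflected into `ℍ⁺`) and signs `εⱼ`
with `[T(z), t⁻³] − k · Σⱼ εⱼ [T(uⱼ), t⁻³] ∈ KZ.relations`. [cite: Zagier2007Dilogarithm, Ch. I §2] -/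
theorem distribution_idealTetrahedronRep (k : ℕ) (hk : 1 ≤ k) (z : ℂ) (hz : IsAlgebraic ℚ z) (him : 0 < z.im) :
    ∃ (u : Fin k → ℂ) (hu : ∀ j, IsAlgebraic ℚ (u j)) (hui : ∀ j, 0 < (u j).im) (ε : Fin k → ℤ),
      KZ.of (KZ.idealTetrahedronRep z hz him) -
        k • ∑ j, ε j • KZ.of (KZ.idealTetrahedronRep (u j) (hu j) (hui j)) ∈ KZ.relations := by
  obtain ⟨ρ, hρ⟩ := distribution_exists_standardFamily
  have hadm : ∀ c : ℂ, IsAlgebraic ℚ c → 0 < c.im → (ρ c).domain = idealTetrahedron c ∧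
      EqOn (ρ c).integrand (fun p => 1 / p 2 ^ 3) (idealTetrahedron c) := fun c hc hci => by
    rw [hρ c hc hci]
    exact ⟨rfl, fun _ _ => rfl⟩
  obtain ⟨u, ε, hu, hui, hrel⟩ := stub_distribution idealTetrahedron (fun _ => rfl) ρ hadm k hk z hz him
  refine ⟨u, hu, hui, ε, ?_⟩
  have h1 : ρ z = KZ.idealTetrahedronRep z hz him := hρ z hz him
  have h2 : ∑ j, ε j • KZ.of (ρ (u j)) = ∑ j, ε j • KZ.of (KZ.idealTetrahedronRep (u j) (hu j) (hui j)) :=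
    Finset.sum_congr rfl fun j _ => by rw [hρ (u j) (hu j) (hui j)]
  rw [← h1, ← h2]
  exact hrel

/-- **The distribution relations for the hyperbolic volumes of the standard ideal tetrahedra**, from the soundness of
the calculus: `vol T(z) = k · Σⱼ εⱼ vol T(uⱼ)` for the points and signs of `distribution_idealTetrahedronRep`.
[cite: Zagier2007Dilogarithm, Ch. I §2] -/
theorem idealTetrahedronVolume_distribution (k : ℕ) (hk : 1 ≤ k) (z : ℂ) (hz : IsAlgebraic ℚ z)
    (him : 0 < z.im) :
    ∃ (u : Fin k → ℂ) (ε : Fin k → ℤ), (∀ j, IsAlgebraic ℚ (u j)) ∧ (∀ j, 0 < (u j).im) ∧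
      idealTetrahedronVolume z = k * ∑ j, (ε j : ℝ) * idealTetrahedronVolume (u j) := by
  obtain ⟨u, hu, hui, ε, hrel⟩ := distribution_idealTetrahedronRep k hk z hz him
  refine ⟨u, ε, hu, hui, ?_⟩
  have h := KZ.eval_eq_zero_of_mem_relations hrel
  simp only [map_sub, map_nsmul, map_sum, map_zsmul, KZ.eval_of, KZ.value_idealTetrahedronRep,
    nsmul_eq_mul, zsmul_eq_mul, sub_eq_zero] at h
  exact h

/-- **The distribution relations of the Bloch–Wigner dilogarithm at algebraic arguments** (Zagier's ray integral
`KZ.rayDilog`, identified with the volume by the Milnor bridge `value_idealTetrahedronRep_eq_rayDilog`):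
`D(z) = k · Σⱼ εⱼ D(uⱼ)`. [cite: Zagier2007Dilogarithm, Ch. I §2] -/
theorem rayDilog_distribution (k : ℕ) (hk : 1 ≤ k) (z : ℂ) (hz : IsAlgebraic ℚ z) (him : 0 < z.im) :
    ∃ (u : Fin k → ℂ) (ε : Fin k → ℤ), (∀ j, IsAlgebraic ℚ (u j)) ∧ (∀ j, 0 < (u j).im) ∧
      KZ.rayDilog z.re z.im = k * ∑ j, (ε j : ℝ) * KZ.rayDilog (u j).re (u j).im := by
  obtain ⟨u, hu, hui, ε, hrel⟩ := distribution_idealTetrahedronRep k hk z hz him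
  refine ⟨u, ε, hu, hui, ?_⟩
  have h := KZ.eval_eq_zero_of_mem_relations hrel
  simp only [map_sub, map_nsmul, map_sum, map_zsmul, KZ.eval_of, value_idealTetrahedronRep_eq_rayDilog,
    nsmul_eq_mul, zsmul_eq_mul, sub_eq_zero] at h
  exact h

end Summit.KontsevichZagierPeriods.HyperbolicBloch.OffTetraSectorKernel

end
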